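import Summits.ABC.IUTFork.Cor312FrameVolumePiecesDHArch
import Summits.ABC.IUTFork.Cor312EdgeAggregateRealIVT
import HarnessLib

/-!
# [IUTchIII] Corollary 3.12 — the intermediate-value hypothesis `hivt` of the aggregate Reading-4 chain HOLDS at the
# GENUINE pieces: the archimedean packets of the real log-shells with radial factor volumes

PROOF-ONLY record file (D-0012) of the abc-iut cell (Cor. 3.12 sub-crew, seat abc-iut-c312-6, gen 5; TEAM B real-setting
lane); TAKES NO SIDE; 0 `def`s, 0 `Prop` facts. abc-iut-w5-d204's `Cor312EdgeAggregatePilotIVT` (p413937) and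
abc-iut-w5-d166's `Cor312EdgeAggregateRealIVT` (p416763) reduce V-e's aggregate Reading 4 (`QCongruentSubHullAgg`,
Yamashita2024IUTSurvey Cor. 13.13 proof p. 360 ll. 30–40) to the aggregate inequality PLUS the binder package
`(hV : V.Realizes (S.D n))`, `i₀`, `(hw : 0 < w_{i₀})`, `(hvol : ∀ t, ∃ r > 0, μ^log_{i₀}(B(0,r)) = t)` at ONE packet of a
`FrameVolumePieces` `V`; w5-d166's `Cor312VolumesRealFramesNonVacuity` (p422829) showed the package JOINTLY SATISFIABLE
at a MODEL (`ℂ` copies over degenerate line data, «not initial Θ-data»). THIS file discharges the package at the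
GENUINE pieces of the companion `Cor312FrameVolumePiecesDHArch` — the field-box volume pieces of the real log-shells of a
number field `F ∋ √−1` with RADIAL archimedean factors (c312-6 `FactorVolume.complexRadial` on the copies of `ℂ` of
L5-t7's `Φ₀ : M_I ≅ ⊕_{(w,ε)} ℂ`, weights `|J|⁻¹`), at EVERY label `j` and the archimedean place `v_ℚ = ∞`:

* `nonempty_factorIdxDHArch_inl` — the archimedean packet at `(j, ∞)` HAS a field factor (`F` has an archimedean place:
  c312-1's `Nonempty (T.Fibre v_ℚ)`; the capsule index is inhabited);
* `frameWeight_settingDHFramesArch_inl_pos` — its weight `|J|⁻¹` is POSITIVE; `factorVolume_settingDHFramesArch_inl_archType`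
  — its volume takes EVERY real log-volume on closed discs (w5-d166 `complexRadial_exists_logvol_closedBall_eq`);
* `realizes` is the companion's `realizes_situationDHFramesArch` (`rfl`);
* hence **`hullIVTAt_settingDHFramesArch_inl`**: for the twin setting `Real.settingDHFramesArch` (binders EXACTLY those of
  w5-d163's `Real.settingDHVolArch`), at every `(j, ∞)` where the hull `^{n,∘}𝒰_{j,∞}` is defined, every real
  `y ≤ μ^log(^{n,∘}𝒰_{j,∞})` is the log-volume of an admissible sub-region of `^{n,∘}𝒰_{j,∞}` — w5-d166's
  `FrameVolumePieces.hullIVTAt_ofFrames` with `hV`/`i₀`/`hw`/`hvol` ALL SUPPLIED by the genuine data (only `HullDefined`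
  at that packet remains, as in print: "admits its holomorphic hull").
So the sentence of p413937/p416763 («with the print's global quantifier, Reading 4 carries no content beyond the
inequality once one component has intermediate values») has its intermediate-value premise met by THE ARCHIMEDEAN
PACKETS OF THE SETTING OF RECORD (archimedean place honest), not only by a model. Bookkeeping over landed decls; no side
taken on [IUTchIII] Cor. 3.12; typed ≠ proved; instantiated ≠ endorsed.
[cite: MochizukiAbsTopIII2015, Prop. 5.7 (ii) p. 138] [cite: Yamashita2024IUTSurvey, Cor. 13.13 proof p. 360 ll. 30–40]
[claim: Mochizuki2012, status: disputed]
-/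

noncomputable section

open Set Function Metric NumberField

namespace Summit.ABC

namespace IUTFork

namespace Thm311

namespace Real

open Cor312 Cor312Vol Literature.IUT.LogThetaLattice Literature.IUT.LogVolume

variable {F : Type} [Field F] [NumberField F] (X : PilotData F) {logv : PadicLogs F} (hlog : LogvAnalytic logv)
  (hc : ∀ w : InfinitePlace F, w.IsComplex)

/-- **The archimedean packet at `(j, ∞)` has a field factor**: the index `V(F)_∞^{S^±_{j+1}} × {±}^{S^±_{j+1}∖{i₀}}` of the
copies of `ℂ` is inhabited (`F` has an archimedean place — c312-1's `Nonempty (T.Fibre v_ℚ)`).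
[cite: Mochizuki2012, IUTchIV Prop. 1.5 (iii) p. 15] -/
theorem nonempty_factorIdxDHArch_inl (j : (thetaIndex X).Label) : Nonempty (factorIdxDHArch X hlog j (.inl ())) :=
  (inferInstance : Nonempty (ArchPresentation.J (T := thetaIndex X) (Sum.inl ()) j))

/-- The weight `|J|⁻¹` of every archimedean field factor of the pieces is POSITIVE. [folklore] -/
theorem frameWeightDHArch_inl_pos (j : (thetaIndex X).Label) (s : factorIdxDHArch X hlog j (.inl ())) :
    0 < (frameVolumePiecesDHArch X hlog hc).w j (.inl ()) s := by
  haveI := nonempty_factorIdxDHArch_inl X hlog j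
  show 0 < ((Fintype.card (factorIdxDHArch X hlog j (.inl ()))) : ℝ)⁻¹
  exact inv_pos.mpr (by exact_mod_cast Fintype.card_pos)

/-- **Every archimedean field factor of the pieces is archimedean-type**: its (radial) volume takes every real
log-volume on closed discs, `μ^log_ℂ(B(0, e^t)) = t` (w5-d166 `complexRadial_exists_logvol_closedBall_eq`).
[cite: MochizukiAbsTopIII2015, Prop. 5.7 (ii) p. 138] -/
theorem factorVolumeDHArch_inl_archType (j : (thetaIndex X).Label) (s : factorIdxDHArch X hlog j (.inl ())) (t : ℝ) :
    ∃ r : ℝ, 0 < r ∧ ((frameVolumePiecesDHArch X hlog hc).vol j (.inl ()) s).logvol (closedBall 0 r) = t :=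
  FactorVolume.complexRadial_exists_logvol_closedBall_eq t

/-- **w5-d166's binder package `(i₀, hw, hvol)` at the GENUINE pieces**, every label `j`, archimedean place: some field
factor of positive weight whose volume is archimedean-type. [folklore] -/
theorem exists_archType_factor_inl (j : (thetaIndex X).Label) :
    ∃ i₀ : (frameVolumePiecesDHArch X hlog hc).J j (.inl ()), 0 < (frameVolumePiecesDHArch X hlog hc).w j (.inl ()) i₀ ∧
      ∀ t : ℝ, ∃ r : ℝ, 0 < r ∧ ((frameVolumePiecesDHArch X hlog hc).vol j (.inl ()) i₀).logvol (closedBall 0 r) = t := by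
  obtain ⟨s⟩ := nonempty_factorIdxDHArch_inl X hlog j
  exact ⟨s, frameWeightDHArch_inl_pos X hlog hc j s, factorVolumeDHArch_inl_archType X hlog hc j s⟩

section Setting

variable (M : Type) [Field M] [NumberField M]
  (archPk : ∀ (j : (thetaIndex X).Label) (vQ : (thetaIndex X).VQ), Set ((logShellsDH X logv).Packet j vQ))
  (archSub : ∀ (j : (thetaIndex X).Label) (v : (thetaIndex X).V),
    Set ((logShellsDH X logv).Packet j ((thetaIndex X).over v)))
  (Ψ : ℤ → ∀ v : (thetaIndex X).V, v ∈ (thetaIndex X).Vbad → Set ((logShellsDH X logv).StarPacket v))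
  (act : ℤ → ∀ v : (thetaIndex X).V, v ∈ (thetaIndex X).Vbad →
    (logShellsDH X logv).StarPacket v → Module.End ℚ ((logShellsDH X logv).StarPacket v))
  (Mmod : ℤ → ∀ j : (thetaIndex X).LabelStar, Set ((logShellsDH X logv).GlobalPacket j.1))
  (region : ℤ → ∀ j : (thetaIndex X).LabelStar, FinDivisor M → ∀ vQ : (thetaIndex X).VQ,
    Set ((logShellsDH X logv).Packet j.1 vQ))
  (n : ℤ) {HT : Type} {LogLink : HT → HT → Type} {IsFull : ∀ {s t : HT}, LogLink s t → Prop}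
  (lat : LGPGaussianLogThetaLattice LogLink IsFull)
  {Frd : Type} {IsoF : Frd → Frd → Type} {Ob : Frd → Type} {realify : Frd → Frd} {Strip : Type}
  {IsoS : Strip → Strip → Type} {Mv : ∀ v : (thetaIndex X).V, v ∈ (thetaIndex X).Vbad → Type}
  [∀ v h, Monoid (Mv v h)]
  (sig : GlobalLGPFrobenioidSignature (thetaIndex X).lstar (thetaIndex X).V (· ∈ (thetaIndex X).Vbad)
    Frd IsoF Ob realify Strip IsoS Mv)
  (split : SplittingMonoids Mv) {ObΔ : Type} {N : ∀ v : (thetaIndex X).V, v ∈ (thetaIndex X).Vbad → Type}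
  [∀ v h, Monoid (N v h)] (qData : QPilotData ObΔ N)
  (thetaBox : ℤ → Ob sig.Clgp → ∀ (j : (thetaIndex X).Label) (vQ : (thetaIndex X).VQ),
    Set (∀ s : factorIdxDHArch X hlog j vQ, factorFieldDHArch X hlog j vQ s))
  (qCentre : ObΔ → ∀ (j : (thetaIndex X).Label) (vQ : (thetaIndex X).VQ),
    ∀ s : factorIdxDHArch X hlog j vQ, factorFieldDHArch X hlog j vQ s)
  (hq : ∀ j vQ s, qCentre (qPilotObject qData) j vQ s ≠ 0)
  (hfin : ∀ j : (thetaIndex X).Label, (Function.support fun vQ =>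
    ((situationDHVolArch X hlog hc M archPk archSub Ψ act Mmod region).D n).logvol j vQ
      (factorMapDHArch X hlog hc j vQ ⁻¹' hullSet (factorFieldDHArch X hlog j vQ)
        (qCentre (qPilotObject qData) j vQ))).Finite)

/-- **`hivt` HOLDS at the archimedean packets of the setting of record (radial field-box volumes).** For the twin
setting `Real.settingDHFramesArch` (binders exactly those of w5-d163's `Real.settingDHVolArch`), at every `(j, ∞)` where
`^{n,∘}𝒰_{j,∞}` admits its hull, every real `y ≤ μ^log(^{n,∘}𝒰_{j,∞})` is the log-volume of an ADMISSIBLE sub-region of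
`^{n,∘}𝒰_{j,∞}` — w5-d166's `FrameVolumePieces.hullIVTAt_ofFrames` with `hV`, `i₀`, `hw`, `hvol` supplied by the genuine
data. [cite: Yamashita2024IUTSurvey, Cor. 13.13 proof p. 360 ll. 30–40] -/
theorem hullIVTAt_settingDHFramesArch_inl (j : (thetaIndex X).Label)
    (hdef : (settingDHFramesArch X hlog hc M archPk archSub Ψ act Mmod region n lat sig split qData thetaBox qCentre hq
      hfin).HullDefined j (.inl ()))
    {y : ℝ} (hy : y ≤ ((situationDHFramesArch X hlog hc M archPk archSub Ψ act Mmod region).D n).logvol j (.inl ())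
      ((settingDHFramesArch X hlog hc M archPk archSub Ψ act Mmod region n lat sig split qData thetaBox qCentre hq
        hfin).thetaHull j (.inl ()))) :
    ∃ R : Set ((logShellsDH X logv).Packet j (.inl ())),
      ((situationDHFramesArch X hlog hc M archPk archSub Ψ act Mmod region).D n).Adm j (.inl ()) R ∧
        R ⊆ (settingDHFramesArch X hlog hc M archPk archSub Ψ act Mmod region n lat sig split qData thetaBox qCentre hq
          hfin).thetaHull j (.inl ()) ∧
        ((situationDHFramesArch X hlog hc M archPk archSub Ψ act Mmod region).D n).logvol j (.inl ()) R = y := by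
  obtain ⟨i₀, hw, hvol⟩ := exists_archType_factor_inl X hlog hc j
  exact FrameVolumePieces.hullIVTAt_ofFrames (S := situationDHFramesArch X hlog hc M archPk archSub Ψ act Mmod region)
    (frameVolumePiecesDHArch X hlog hc) lat sig split qData thetaBox qCentre hq
    (FrameVolumePieces.hadm_of_realizes (S := situationDHFramesArch X hlog hc M archPk archSub Ψ act Mmod region)
      (V := frameVolumePiecesDHArch X hlog hc)
      (realizes_situationDHFramesArch X hlog hc M archPk archSub Ψ act Mmod region n))
    (fun j => (qSupport_framesArch_eq X hlog hc M archPk archSub Ψ act Mmod region n qData qCentre hq j).symm ▸ hfin j)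
    (realizes_situationDHFramesArch X hlog hc M archPk archSub Ψ act Mmod region n) j (.inl ()) hdef i₀ hw hvol hy

/-- The same read in w5-d163's VERBATIM archimedean-honest container: the admissible sub-region found above is a
field-box of the archimedean packet, and the hull's log-volume there is the SAME number in both containers
(companion `thetaLocal_settingDHFramesArch`); stated here as the transfer of the HYPOTHESIS `y ≤ μ^log(𝒰)` between the
two readings of `𝕄(−)` under `HullDefined`. [folklore] -/
theorem logvol_thetaHull_settingDHFramesArch_eq (j : (thetaIndex X).Label) (vQ : (thetaIndex X).VQ)
    (hdef : (settingDHFramesArch X hlog hc M archPk archSub Ψ act Mmod region n lat sig split qData thetaBox qCentre hq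
      hfin).HullDefined j vQ) :
    ((situationDHFramesArch X hlog hc M archPk archSub Ψ act Mmod region).D n).logvol j vQ
        ((settingDHFramesArch X hlog hc M archPk archSub Ψ act Mmod region n lat sig split qData thetaBox qCentre hq
          hfin).thetaHull j vQ) =
      ((situationDHVolArch X hlog hc M archPk archSub Ψ act Mmod region).D n).logvol j vQ
        ((settingDHVolArch X hlog hc M archPk archSub Ψ act Mmod region n lat sig split qData thetaBox qCentre hq
          hfin).thetaHull j vQ) := by
  have h := thetaLocal_settingDHFramesArch X hlog hc M archPk archSub Ψ act Mmod region n lat sig split qData thetaBox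
    qCentre hq hfin j vQ
  unfold Cor312.Setting.thetaLocal at h
  rw [if_pos hdef, if_pos ((hullDefined_settingDHFramesArch_iff X hlog hc M archPk archSub Ψ act Mmod region n lat sig
    split qData thetaBox qCentre hq hfin j vQ).mp hdef)] at h
  exact_mod_cast h

end Setting

end Real

end Thm311

end IUTFork

end Summit.ABC

end
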